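import Literature.Probability.LatticeModels.TorusBlockKernels
import HarnessLib

/-!
# A pointwise floor for block kernels of positive-semidefinite translation-invariant kernels

Let `K` be a symmetric, translation-invariant, POSITIVE-SEMIDEFINITE kernel on the discrete torus
`(ℤ/Mℤ)^d`, `M = b·m`, and let `K_b(x, y) = Σ_{x' ∈ block x, y' ∈ block y} K(x', y')` be its `b`-block
kernel (vocabulary of `TorusBlockKernels.lean`: nothing is defined, block membership is written
`∀ i, (x' i).val / b = (x i).val / b`). Write `Λ = Σ_{x,y} K(x,y)` (the "order parameter sum",
`= ⟨S⁺_tot S⁻_tot⟩` for a transverse spin kernel). Then for ALL `x, y`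

  `K_b(x, y) ≥ 2 b^{2d} Λ / M^{2d} - K_b(0, 0)`            (`TorusBlock.blockKernel_floor`),

equivalently for the coarse kernel `k_b(X) ≥ 2 b^{2d} Λ / M^{2d} - k_b(0)` for every coarse site `X`
(`TorusBlock.coarseKernel_floor`). This is the Bochner floor `f(X) ≥ 2 f̂(0)/|G| - f(0)` of a
positive-definite function on a finite abelian group, applied to the coarse kernel; it is proved
here WITHOUT Fourier analysis, by testing positive-semidefiniteness on the single vector
`1_{block x} + 1_{block y} - (2 b^d / M^d)·1` (`crossSum_floor_of_posSemidef`, any finite index set,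
constant row sums).

Use (route `HubbardSuperconductivity/LevyLogBootstrap`, input (c) "pointwise planar-order anchor"
of `LevyTransport`): the block term `2 b^{2d} Λ/M^{2d}` is COHERENT (`∝ b^{2d}` times the Cesàro
long-range order `Λ/M^{2d}`), while `K_b(0,0) - b^{2d}Λ/M^{2d} = M^{-d} Σ_{q ≠ 0} K̂(q) |1̂_{block}(q)|²`
is controlled by an infrared bound and grows only like `b^{2d-1}`; so Cesàro long-range order plus an
infrared bound give a POSITIVE pointwise floor for all block kernels with `b ≥ b₀` — no correlation
(Griffiths/monotonicity) inequality is needed. The remainder estimate is not part of this file.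

Sources: the Bochner floor is standard finite-group harmonic analysis (W. Rudin, *Fourier Analysis
on Groups* (1962) §1.4; C. Berg, J. P. R. Christensen, P. Ressel (1984) Ch. 3 §1, positive definite
kernels and their quadratic forms); the one-vector proof and the block application are elementary
(folklore). No definition is introduced.
-/

noncomputable section

open Finset
open scoped BigOperators

namespace Literature.Probability.LatticeModels

/-! ### The one-vector floor for positive-semidefinite kernels with constant row sums -/

/-- **Cross-sum floor for a positive-semidefinite kernel with constant row sums.** Let `K` be a
symmetric kernel on a nonempty finite set `X` whose real quadratic form is nonnegative and whose row
sums all equal `r`. For weights `u, v : X → ℝ` of equal total mass `n`,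
`Σ_{x,y} u_x v_y K(x,y) ≥ 2 n² r / |X| - (Σ u_x u_y K + Σ v_x v_y K)/2`.
Proof: expand `0 ≤ Q(u + v - t·1)` with `t = 2n/|X|`, using `Σ_y K(x,y) = r`. [folklore] -/
theorem crossSum_floor_of_posSemidef {X : Type*} [Fintype X] [Nonempty X] (K : X → X → ℝ)
    (hS : ∀ x y, K x y = K y x) (hP : ∀ c : X → ℝ, 0 ≤ ∑ x, ∑ y, c x * c y * K x y)
    (r : ℝ) (hrow : ∀ x, ∑ y, K x y = r) (u v : X → ℝ) (n : ℝ)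
    (hu : ∑ x, u x = n) (hv : ∑ x, v x = n) :
    2 * n ^ 2 * r / (Fintype.card X : ℝ) -
        ((∑ x, ∑ y, u x * u y * K x y) + (∑ x, ∑ y, v x * v y * K x y)) / 2 ≤
      ∑ x, ∑ y, u x * v y * K x y := by
  set N : ℝ := (Fintype.card X : ℝ) with hN
  have hNpos : 0 < N := by
    rw [hN]
    exact_mod_cast Fintype.card_pos
  -- column sums are row sums
  have hcol : ∀ y, ∑ x, K x y = r := fun y => by
    rw [show (∑ x, K x y) = ∑ x, K y x from Finset.sum_congr rfl fun x _ => hS x y]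
    exact hrow y
  have htot : ∑ x, ∑ y, K x y = N * r := by
    simp_rw [hrow]
    rw [Finset.sum_const, Finset.card_univ, nsmul_eq_mul]
  -- the symmetric cross term
  have hsym : ∑ x, ∑ y, v x * u y * K x y = ∑ x, ∑ y, u x * v y * K x y := by
    rw [Finset.sum_comm]
    refine Finset.sum_congr rfl fun x _ => Finset.sum_congr rfl fun y _ => ?_
    rw [hS y x]; ring
  set t : ℝ := 2 * n / N with ht
  -- linear terms
  have hlin1 : ∑ x, ∑ y, t * ((u x + v x) * K x y) = t * (2 * n * r) := by
    have : ∀ x, ∑ y, t * ((u x + v x) * K x y) = t * ((u x + v x) * r) := fun x => by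
      rw [← Finset.mul_sum, ← Finset.mul_sum, hrow x]
    simp_rw [this]
    rw [← Finset.mul_sum, ← Finset.sum_mul, Finset.sum_add_distrib, hu, hv]; ring
  have hlin2 : ∑ x, ∑ y, t * ((u y + v y) * K x y) = t * (2 * n * r) := by
    rw [Finset.sum_comm]
    have : ∀ y, ∑ x, t * ((u y + v y) * K x y) = t * ((u y + v y) * r) := fun y => by
      rw [← Finset.mul_sum, ← Finset.mul_sum, hcol y]
    simp_rw [this]
    rw [← Finset.mul_sum, ← Finset.sum_mul, Finset.sum_add_distrib, hu, hv]; ring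
  have hquad : ∑ x, ∑ y, t ^ 2 * K x y = t ^ 2 * (N * r) := by
    rw [← htot, Finset.mul_sum]
    refine Finset.sum_congr rfl fun x _ => ?_
    rw [Finset.mul_sum]
  have key := hP fun x => u x + v x - t
  have hexp : ∀ x y, (u x + v x - t) * (u y + v y - t) * K x y =
      u x * u y * K x y + v x * v y * K x y + (u x * v y * K x y + v x * u y * K x y)
        - t * ((u x + v x) * K x y) - t * ((u y + v y) * K x y) + t ^ 2 * K x y := by
    intro x y; ring
  simp_rw [hexp, Finset.sum_add_distrib, Finset.sum_sub_distrib, Finset.sum_add_distrib] at key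
  rw [hsym, hlin1, hlin2, hquad] at key
  -- `key : 0 ≤ Suu + Svv + (Suv + Suv) - t(2nr) - t(2nr) + t² N r`
  have hval : t * (2 * n * r) + t * (2 * n * r) - t ^ 2 * (N * r) = 4 * n ^ 2 * r / N := by
    rw [ht]; field_simp; ring
  have h2 : 2 * n ^ 2 * r / N = (4 * n ^ 2 * r / N) / 2 := by ring
  rw [h2, ← hval]
  linarith

/-! ### Block kernels on the torus -/

namespace TorusBlock

variable {d b m M : ℕ} [NeZero M] [NeZero m]

omit [NeZero m] in
/-- `|(ℤ/Mℤ)^d| = M^d`. [folklore] -/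
theorem card_torusSite_eq_pow : Fintype.card (TorusSite d M) = M ^ d := by
  simp [Fintype.card_pi, ZMod.card]

omit [NeZero m] in
/-- Row sums of a translation-invariant kernel are constant: `Σ_y K(x,y) = Σ_y K(0,y)`. [folklore] -/
theorem rowSum_eq_rowSum_zero (K : TorusSite d M → TorusSite d M → ℝ)
    (hT : ∀ v x y : TorusSite d M, K (x + v) (y + v) = K x y) (x : TorusSite d M) :
    ∑ y, K x y = ∑ y, K 0 y := by
  have h : ∀ y, K x y = K 0 (y - x) := fun y => by
    have := hT x 0 (y - x)
    rw [zero_add, sub_add_cancel] at this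
    exact this
  simp_rw [h]
  exact Fintype.sum_equiv (Equiv.subRight x) _ _ fun y => rfl

omit [NeZero m] in
/-- The total sum of a translation-invariant kernel is `M^d` row sums:
`Σ_{x,y} K(x,y) = M^d · Σ_y K(0,y)`. [folklore] -/
theorem sum_sum_eq_card_mul_rowSum (K : TorusSite d M → TorusSite d M → ℝ)
    (hT : ∀ v x y : TorusSite d M, K (x + v) (y + v) = K x y) :
    ∑ x, ∑ y, K x y = (M : ℝ) ^ d * ∑ y, K 0 y := by
  simp_rw [rowSum_eq_rowSum_zero K hT]
  rw [Finset.sum_const, Finset.card_univ, card_torusSite_eq_pow, nsmul_eq_mul, Nat.cast_pow]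

omit [NeZero m] in
/-- The block indicator has total mass `b^d`: `Σ_{x'} 1[block x' = block x] = b^d`. [folklore] -/
theorem sum_blockIndicator (hM : M = b * m) (x : TorusSite d M) :
    ∑ x' : TorusSite d M, (if ∀ i : Fin d, (x' i).val / b = (x i).val / b then (1 : ℝ) else 0) =
      (b : ℝ) ^ d := by
  classical
  haveI : NeZero m := ⟨by rintro rfl; exact NeZero.ne M (by rw [hM, mul_zero])⟩
  set X : TorusSite d m := fun i => (((x i).val / b : ℕ) : ZMod m) with hX
  have hXval : ∀ i, (X i).val = (x i).val / b := fun i => by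
    rw [hX]
    simp only
    rw [ZMod.val_natCast, Nat.mod_eq_of_lt (val_div_lt hM x i)]
  rw [Finset.sum_boole]
  have hflt : (univ.filter fun x' : TorusSite d M => ∀ i : Fin d, (x' i).val / b = (x i).val / b) =
      univ.filter fun x' : TorusSite d M => ∀ i : Fin d, (x' i).val / b = (X i).val := by
    refine Finset.filter_congr fun x' _ => ?_
    simp_rw [hXval]
  rw [hflt, card_filter_block hM X, Nat.cast_pow]

omit [NeZero M] [NeZero m] in
/-- Product of two block indicators times the kernel is the block-restricted kernel. [folklore] -/
theorem blockIndicator_mul (K : TorusSite d M → TorusSite d M → ℝ) (x y x' y' : TorusSite d M) :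
    (if ∀ i : Fin d, (x' i).val / b = (x i).val / b then (1 : ℝ) else 0) *
        (if ∀ i : Fin d, (y' i).val / b = (y i).val / b then (1 : ℝ) else 0) * K x' y' =
      if (∀ i : Fin d, (x' i).val / b = (x i).val / b) ∧ (∀ i : Fin d, (y' i).val / b = (y i).val / b)
      then K x' y' else 0 := by
  by_cases h1 : ∀ i : Fin d, (x' i).val / b = (x i).val / b <;>
    by_cases h2 : ∀ i : Fin d, (y' i).val / b = (y i).val / b <;> simp [h1, h2]

/-- **Diagonal block sums are all equal**: `K_b(x, x) = K_b(0, 0)` for translation-invariant `K`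
(both are the coarse kernel at `0`). [folklore] -/
theorem blockKernel_diag_eq (hM : M = b * m) (K : TorusSite d M → TorusSite d M → ℝ)
    (hT : ∀ v x y : TorusSite d M, K (x + v) (y + v) = K x y) (x : TorusSite d M) :
    (∑ x' : TorusSite d M, ∑ y' : TorusSite d M,
      if (∀ i : Fin d, (x' i).val / b = (x i).val / b) ∧ (∀ i : Fin d, (y' i).val / b = (x i).val / b)
      then K x' y' else 0) =
    ∑ x' : TorusSite d M, ∑ y' : TorusSite d M,
      if (∀ i : Fin d, (x' i).val / b = ((0 : TorusSite d M) i).val / b) ∧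
          (∀ i : Fin d, (y' i).val / b = ((0 : TorusSite d M) i).val / b)
      then K x' y' else 0 := by
  rw [blockKernel_eq_coarse hM K hT x x, blockKernel_eq_coarse hM K hT 0 0, sub_self, sub_self]

/-- **Pointwise floor for block kernels (fine-torus form).** For `M = b·m` and a symmetric,
translation-invariant kernel `K` on `(ℤ/Mℤ)^d` with nonnegative real quadratic form, every entry of
the `b`-block kernel is bounded below by the coherent block term minus the diagonal block sum:
`K_b(x, y) ≥ 2 b^{2d} (Σ_{x',y'} K)/M^{2d} - K_b(0, 0)`. (Bochner floor of the coarse kernel; here: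
`crossSum_floor_of_posSemidef` with the two block indicators, row sums `Σ_y K(0,y) = Λ/M^d`.)
[folklore] -/
theorem blockKernel_floor (hM : M = b * m) (K : TorusSite d M → TorusSite d M → ℝ)
    (hT : ∀ v x y : TorusSite d M, K (x + v) (y + v) = K x y) (hS : ∀ x y : TorusSite d M, K x y = K y x)
    (hP : ∀ c : TorusSite d M → ℝ, 0 ≤ ∑ x, ∑ y, c x * c y * K x y) (x y : TorusSite d M) :
    2 * ((b : ℝ) ^ d) ^ 2 * (∑ x' : TorusSite d M, ∑ y' : TorusSite d M, K x' y') / ((M : ℝ) ^ d) ^ 2 -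
        (∑ x' : TorusSite d M, ∑ y' : TorusSite d M,
          if (∀ i : Fin d, (x' i).val / b = ((0 : TorusSite d M) i).val / b) ∧
              (∀ i : Fin d, (y' i).val / b = ((0 : TorusSite d M) i).val / b)
          then K x' y' else 0) ≤
      ∑ x' : TorusSite d M, ∑ y' : TorusSite d M,
        if (∀ i : Fin d, (x' i).val / b = (x i).val / b) ∧ (∀ i : Fin d, (y' i).val / b = (y i).val / b)
        then K x' y' else 0 := by
  classical
  set r : ℝ := ∑ y', K 0 y' with hr
  have hrow : ∀ x', ∑ y', K x' y' = r := fun x' => rowSum_eq_rowSum_zero K hT x'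
  set u : TorusSite d M → ℝ := fun x' => if ∀ i : Fin d, (x' i).val / b = (x i).val / b then 1 else 0
    with hu
  set v : TorusSite d M → ℝ := fun y' => if ∀ i : Fin d, (y' i).val / b = (y i).val / b then 1 else 0
    with hv
  have hun : ∑ x', u x' = (b : ℝ) ^ d := sum_blockIndicator hM x
  have hvn : ∑ y', v y' = (b : ℝ) ^ d := sum_blockIndicator hM y
  have key := crossSum_floor_of_posSemidef K hS hP r hrow u v ((b : ℝ) ^ d) hun hvn
  have huv : ∑ x', ∑ y', u x' * v y' * K x' y' = ∑ x' : TorusSite d M, ∑ y' : TorusSite d M,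
      if (∀ i : Fin d, (x' i).val / b = (x i).val / b) ∧ (∀ i : Fin d, (y' i).val / b = (y i).val / b)
      then K x' y' else 0 :=
    Finset.sum_congr rfl fun x' _ => Finset.sum_congr rfl fun y' _ => blockIndicator_mul K x y x' y'
  have huu : ∑ x', ∑ y', u x' * u y' * K x' y' = ∑ x' : TorusSite d M, ∑ y' : TorusSite d M,
      if (∀ i : Fin d, (x' i).val / b = ((0 : TorusSite d M) i).val / b) ∧
          (∀ i : Fin d, (y' i).val / b = ((0 : TorusSite d M) i).val / b)
      then K x' y' else 0 := by
    rw [← blockKernel_diag_eq hM K hT x]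
    exact Finset.sum_congr rfl fun x' _ => Finset.sum_congr rfl fun y' _ =>
      blockIndicator_mul K x x x' y'
  have hvv : ∑ x', ∑ y', v x' * v y' * K x' y' = ∑ x' : TorusSite d M, ∑ y' : TorusSite d M,
      if (∀ i : Fin d, (x' i).val / b = ((0 : TorusSite d M) i).val / b) ∧
          (∀ i : Fin d, (y' i).val / b = ((0 : TorusSite d M) i).val / b)
      then K x' y' else 0 := by
    rw [← blockKernel_diag_eq hM K hT y]
    exact Finset.sum_congr rfl fun x' _ => Finset.sum_congr rfl fun y' _ =>
      blockIndicator_mul K y y x' y'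
  rw [huv, huu, hvv, card_torusSite_eq_pow] at key
  have hΛ : ∑ x' : TorusSite d M, ∑ y' : TorusSite d M, K x' y' = (M : ℝ) ^ d * r :=
    sum_sum_eq_card_mul_rowSum K hT
  rw [hΛ]
  have hne : ((M : ℝ) ^ d) ≠ 0 := by
    have : (0 : ℝ) < M := by exact_mod_cast Nat.pos_of_ne_zero (NeZero.ne M)
    positivity
  have hrew : 2 * ((b : ℝ) ^ d) ^ 2 * ((M : ℝ) ^ d * r) / ((M : ℝ) ^ d) ^ 2 =
      2 * ((b : ℝ) ^ d) ^ 2 * r / ((M ^ d : ℕ) : ℝ) := by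
    rw [Nat.cast_pow, div_eq_div_iff (pow_ne_zero 2 hne) hne]
    ring
  rw [hrew]
  linarith

/-- **Pointwise floor for the coarse block kernel.** Same hypotheses; for every coarse site
`X ∈ (ℤ/mℤ)^d`, `k_b(X) ≥ 2 b^{2d} (Σ_{x',y'} K)/M^{2d} - k_b(0)`, with the coarse kernel
`k_b(X) = Σ_{block x' = X, block y' = 0} K(x', y')` of `TorusBlockKernels.lean`. In particular, if the
right-hand side is positive, `log (k_b(0)/k_b(X)) ≤ log (k_b(0)/floor)` uniformly in `X` (a bound on the
Lévy mass of the block kernel). [folklore] -/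
theorem coarseKernel_floor (hM : M = b * m) (K : TorusSite d M → TorusSite d M → ℝ)
    (hT : ∀ v x y : TorusSite d M, K (x + v) (y + v) = K x y) (hS : ∀ x y : TorusSite d M, K x y = K y x)
    (hP : ∀ c : TorusSite d M → ℝ, 0 ≤ ∑ x, ∑ y, c x * c y * K x y) (X : TorusSite d m) :
    2 * ((b : ℝ) ^ d) ^ 2 * (∑ x' : TorusSite d M, ∑ y' : TorusSite d M, K x' y') / ((M : ℝ) ^ d) ^ 2 -
        (∑ x' : TorusSite d M, ∑ y' : TorusSite d M,
          if (∀ i : Fin d, (x' i).val / b = 0) ∧ (∀ i : Fin d, (y' i).val / b = 0)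
          then K x' y' else 0) ≤
      ∑ x' : TorusSite d M, ∑ y' : TorusSite d M,
        if (∀ i : Fin d, (x' i).val / b = (X i).val) ∧ (∀ i : Fin d, (y' i).val / b = 0)
        then K x' y' else 0 := by
  classical
  -- the section `V ↦ bV` of the coarse map
  set s : TorusSite d M := fun j => ((b * (X j).val : ℕ) : ZMod M) with hs
  have key := blockKernel_floor hM K hT hS hP s 0
  rw [blockKernel_zero_eq_coarse hM K hT s, blockKernel_zero_eq_coarse hM K hT 0] at key
  have hβs : (fun i : Fin d => (((s i).val / b : ℕ) : ZMod m)) = X := coarse_lift hM X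
  have h1 : ∀ i : Fin d, ((((s i).val / b : ℕ) : ZMod m)).val = (X i).val := fun i => by
    rw [congrFun hβs i]
  have h0 : ∀ i : Fin d, (((((0 : TorusSite d M) i).val / b : ℕ) : ZMod m)).val = 0 := fun i => by
    simp [Nat.zero_div]
  simp only [h1, h0] at key
  exact key

end TorusBlock

end Literature.Probability.LatticeModels

end
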